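import Summits.NavierStokesRegularity.NavierStokesRegularity.Theses.QuantisedSymmetry
import Summits.NavierStokesRegularity.NavierStokesRegularity.Theses.DssFarFieldSlaving
import Summits.NavierStokesRegularity.NavierStokesRegularity.Theorems.QuantisedSymmetryPolyhedralTruncationBridge
import Summits.NavierStokesRegularity.NavierStokesRegularity.Theorems.QuantisedSymmetryLiouvilleKillsProfile
import Summits.NavierStokesRegularity.NavierStokesRegularity.Theorems.DssFarFieldSlavingDssTruncationBridge
import Literature.Analysis.FluidPDE.SelfSimilarLiouville
import Literature.Analysis.FluidPDE.HyperbolicDSSOrbit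
import HarnessLib

/-!
# Strategist sketch S21-g10 (second independent strategy census, family `-s`) for crux
# `PolyhedralDssProfileExists` (stmt-NavierStokesRegularity-1404), route `QuantisedSymmetry`

Companion to `STRATEGY-CENSUS-s21.md`. Kernel-checked bookkeeping for the census headings, in the
order the census uses them:

1. `crux_decides` — the crux `X := PolyhedralDssProfileExists` ALONE decides the summit on landed
   theorems (`QuantisedSymmetry.closes` + `quantisedSymmetry_polyhedralTruncationBridge_proof`
   (stmt-11331, PROVED) + `ClayUniqueness_holds` (stmt-0153, PROVED)). Hence any single statement `W`
   replacing `X` in `closes` is summit-deciding by construction; "short of the summit" can only mean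
   a split into `k ≥ 2` open pieces none of which decides.
2. WEAKER INTERMEDIATES read off the summit statement:
   * `W0 := DssFarFieldSlaving.BlowupTypeIDssProfile` (X with the symmetry group dropped = failure of
     the rotated Type-I DSS Liouville wall): `crux_imp_W0`, and `W0_decides` (via the PROVED
     `dssTruncationBridge_proof`, stmt-14477) — still summit-deciding, so not "short of the summit".
   * `NotPolyhedralLiouville := ¬ PolyhedralTypeILiouville` (X with discrete self-similarity dropped;
     the negation of the route's own kill-switch crux #3, stmt-1405): `crux_imp_notPolyhedralLiouville`
     (via the PROVED `quantisedSymmetry_liouvilleKillsProfile_proof`, stmt-1408). Not known to decide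
     the summit (the portability bridge "nontrivial Type-I ancient solution ⇒ blow-up from a rapidly
     decaying datum" is an open crux elsewhere, routes `RobustBlowupPortability`/`TypeILiouville`),
     but it carries the whole existence content of X with its only structural handle (periodicity in
     similarity time) removed.
   * `TypeIAncientProfileExists` (both G and DSS dropped): `crux_imp_typeIAncientProfileExists`.
3. DECOMPOSITION `D_L`: `X ↔ NotPolyhedralLiouville ∧ (NotPolyhedralLiouville → X)`
   (`crux_iff_split_L`; assembly = modus ponens, `trivial_seam`). Typed so the census can say exactly
   which piece keeps the difficulty.
4. STRENGTHENINGS: `AllFactorsProfileExists` (a profile for EVERY factor `c > 1`, the shape of the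
   forward theory Chae–Wolf 2017 / Bradshaw–Tsai 2017) and `HyperbolicPolyhedralProfileExists`
   (a transversally hyperbolic orbit, `Literature.Analysis.FluidPDE.IsHyperbolicTypeIDSSOrbit` with the
   trivial rotation): `crux_of_allFactors`, `crux_of_hyperbolic`.

Nothing here is a new route item; no `sorry`.
-/

-- the summit namespace `…NavierStokesRegularity.NavierStokesRegularity…` is the tree convention (D-0017)
set_option linter.dupNamespace false

namespace Summit.NavierStokesRegularity.NavierStokesRegularity.Cruxes.PolyhedralDssProfileExists.StrategistS21g10

open MeasureTheory Set
open Literature.Analysis.FluidPDE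
open Summit.NavierStokesRegularity.NavierStokesRegularity.Theses

/-! ## 1. The crux alone decides the summit (on landed theorems) -/

/-- `X ⊢ ¬ NavierStokesRegularity` using only PROVED items of the route. [folklore] -/
theorem crux_decides (hX : QuantisedSymmetry.PolyhedralDssProfileExists) :
    ¬ _root_.NavierStokesRegularity :=
  QuantisedSymmetry.closes hX
    Summit.NavierStokesRegularity.NavierStokesRegularity.Theorems.quantisedSymmetry_polyhedralTruncationBridge_proof
    QuantisedSymmetry.ClayUniqueness_holds

/-! ## 2. Weaker intermediates read off the summit statement -/

/-- `X → W0`: dropping the symmetry group lands in the sibling route's crux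
`DssFarFieldSlaving.BlowupTypeIDssProfile` (stmt-0155). [folklore] -/
theorem crux_imp_W0 (hX : QuantisedSymmetry.PolyhedralDssProfileExists) :
    DssFarFieldSlaving.BlowupTypeIDssProfile := by
  obtain ⟨_G, _hfin, _hdet, _hirr, c, hc, u, hanc, hmeas, hdss, hdec, _heqv, hnt⟩ := hX
  intro hL
  exact hnt ((hL c).1 hc u hanc hmeas hdss hdec)

/-- `W0` is itself summit-deciding on landed theorems (`dssTruncationBridge_proof`, stmt-14477,
PROVED), so it is not "short of the summit". [folklore] -/
theorem W0_decides (h : DssFarFieldSlaving.BlowupTypeIDssProfile) : ¬ _root_.NavierStokesRegularity :=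
  DssFarFieldSlaving.closes
    Summit.NavierStokesRegularity.NavierStokesRegularity.Theorems.dssTruncationBridge_proof h

/-- `W_G`: X with discrete self-similarity dropped — the NEGATION of the route's crux #3
`PolyhedralTypeILiouville` (stmt-1405). [folklore] -/
def NotPolyhedralLiouville : Prop := ¬ QuantisedSymmetry.PolyhedralTypeILiouville

/-- `X → ¬ #3`, by the PROVED glue `LiouvilleKillsProfile` (stmt-1408). [folklore] -/
theorem crux_imp_notPolyhedralLiouville (hX : QuantisedSymmetry.PolyhedralDssProfileExists) :
    NotPolyhedralLiouville := fun hL =>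
  Summit.NavierStokesRegularity.NavierStokesRegularity.Theorems.quantisedSymmetry_liouvilleKillsProfile_proof
    hL hX

/-- `W_a`: both the group and the self-similarity dropped — "some nontrivial ancient mild solution
with the Type-I space–time decay exists" (failure of the weak Type-I ancient Liouville statement in
the pointwise-decay class; cf. `Literature.Analysis.FluidPDE.NontrivialMildAncientTypeIExists`, the
Albritton–Barker 2019 Thm 1.1 class). [folklore] -/
def TypeIAncientProfileExists : Prop :=
  ∃ u : ℝ → EuclideanSpace ℝ (Fin 3) → EuclideanSpace ℝ (Fin 3),
    IsAncientMildSolution 1 u ∧ (∀ t < 0, AEStronglyMeasurable (u t) volume) ∧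
      (∃ C₀ : ℝ, HasTypeIDecay C₀ u) ∧ ¬ (∀ t < 0, u t =ᵐ[volume] 0)

/-- `X → W_a` (projection). [folklore] -/
theorem crux_imp_typeIAncientProfileExists (hX : QuantisedSymmetry.PolyhedralDssProfileExists) :
    TypeIAncientProfileExists := by
  obtain ⟨_G, _hfin, _hdet, _hirr, _c, _hc, u, hanc, hmeas, _hdss, hdec, _heqv, hnt⟩ := hX
  exact ⟨u, hanc, hmeas, hdec, hnt⟩

/-! ## 3. Decomposition `D_L` (Liouville failure ∧ DSS-ification) -/

/-- Piece B of `D_L`: "if the `G`-equivariant Type-I ancient class is nonempty (for some polyhedral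
`G`), it contains a discretely self-similar member" — a closed orbit of the scaling semiflow on that
class. No mechanism is known; minimal sets of a semiflow on a compact invariant set need not be
closed orbits. [folklore] -/
def DssificationOfTypeIAncient : Prop :=
  NotPolyhedralLiouville → QuantisedSymmetry.PolyhedralDssProfileExists

/-- The split is exact: `X ↔ A ∧ (A → X)` with `A = ¬ #3`; the assembly is modus ponens
(`trivial_seam`). [folklore] -/
theorem crux_iff_split_L :
    QuantisedSymmetry.PolyhedralDssProfileExists ↔
      (NotPolyhedralLiouville ∧ DssificationOfTypeIAncient) :=
  ⟨fun hX => ⟨crux_imp_notPolyhedralLiouville hX, fun _ => hX⟩, fun h => h.2 h.1⟩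

/-- Assembly of `D_L`, stated in the arrow shape the ledger uses. [folklore] -/
theorem crux_of_split_L (hA : NotPolyhedralLiouville) (hB : DssificationOfTypeIAncient) :
    QuantisedSymmetry.PolyhedralDssProfileExists := hB hA

/-! ## 4. Strengthenings -/

/-- `S⁺_all`: a polyhedral Type-I DSS profile for EVERY factor `c > 1` (the shape of the forward
self-similar theory, where λ-DSS solutions exist for every λ > 1: Chae–Wolf 2017, Bradshaw–Tsai 2017,
in tree `chae_wolf_dss_existence_holds`). [folklore] -/
def AllFactorsProfileExists : Prop :=
  ∀ c : ℝ, 1 < c →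
    ∃ G : Subgroup (EuclideanSpace ℝ (Fin 3) ≃ₗᵢ[ℝ] EuclideanSpace ℝ (Fin 3)), Finite G ∧
      (∀ g ∈ G, LinearMap.det (g.toLinearEquiv :
        EuclideanSpace ℝ (Fin 3) →ₗ[ℝ] EuclideanSpace ℝ (Fin 3)) = 1) ∧
      (∀ V : Submodule ℝ (EuclideanSpace ℝ (Fin 3)), (∀ g ∈ G, ∀ v ∈ V, g v ∈ V) → V = ⊥ ∨ V = ⊤) ∧
      ∃ u : ℝ → EuclideanSpace ℝ (Fin 3) → EuclideanSpace ℝ (Fin 3),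
        IsAncientMildSolution 1 u ∧ (∀ t < 0, AEStronglyMeasurable (u t) volume) ∧
          IsDiscretelySelfSimilar c u ∧ (∃ C₀ : ℝ, HasTypeIDecay C₀ u) ∧
            (∀ g ∈ G, ∀ t x, u t (g x) = g (u t x)) ∧ ¬ (∀ t < 0, u t =ᵐ[volume] 0)

/-- `S⁺_all → X` (take `c = 2`). [folklore] -/
theorem crux_of_allFactors (h : AllFactorsProfileExists) :
    QuantisedSymmetry.PolyhedralDssProfileExists := by
  obtain ⟨G, hfin, hdet, hirr, u, hanc, hmeas, hdss, hdec, heqv, hnt⟩ := h 2 (by norm_num)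
  exact ⟨G, hfin, hdet, hirr, 2, by norm_num, u, hanc, hmeas, hdss, hdec, heqv, hnt⟩

/-- `S⁺_hyp`: a polyhedral profile whose similarity orbit is transversally HYPERBOLIC in the
Gaussian solenoidal space (`IsHyperbolicTypeIDSSOrbit c (refl) u`: compact linearised monodromy,
finitely many multipliers in `|z| ≥ 1`, neutral ones = symmetry modes) — the rigidity that
continuation / radii-polynomial (Newton–Kantorovich) tools would need. [folklore] -/
def HyperbolicPolyhedralProfileExists : Prop :=
  ∃ G : Subgroup (EuclideanSpace ℝ (Fin 3) ≃ₗᵢ[ℝ] EuclideanSpace ℝ (Fin 3)), Finite G ∧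
    (∀ g ∈ G, LinearMap.det (g.toLinearEquiv :
      EuclideanSpace ℝ (Fin 3) →ₗ[ℝ] EuclideanSpace ℝ (Fin 3)) = 1) ∧
    (∀ V : Submodule ℝ (EuclideanSpace ℝ (Fin 3)), (∀ g ∈ G, ∀ v ∈ V, g v ∈ V) → V = ⊥ ∨ V = ⊤) ∧
    ∃ (c : ℝ) (u : ℝ → EuclideanSpace ℝ (Fin 3) → EuclideanSpace ℝ (Fin 3)),
      IsHyperbolicTypeIDSSOrbit c (LinearIsometryEquiv.refl ℝ (EuclideanSpace ℝ (Fin 3))) u ∧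
        (∀ g ∈ G, ∀ t x, u t (g x) = g (u t x))

/-- `S⁺_hyp → X` (forget hyperbolicity and smoothness; rotated-DSS with the trivial rotation is
plain DSS, `isRotatedDSS_refl_iff`). [folklore] -/
theorem crux_of_hyperbolic (h : HyperbolicPolyhedralProfileExists) :
    QuantisedSymmetry.PolyhedralDssProfileExists := by
  obtain ⟨G, hfin, hdet, hirr, c, u, hhyp, heqv⟩ := h
  have hP : IsTypeIDSSProfile c (LinearIsometryEquiv.refl ℝ (EuclideanSpace ℝ (Fin 3))) u :=
    hhyp.toIsTypeIDSSProfile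
  exact ⟨G, hfin, hdet, hirr, c, hP.one_lt, u, hP.isAncientMildSolution, hP.aestronglyMeasurable,
    isRotatedDSS_refl_iff.mp hP.isRotatedDSS, hP.hasTypeIDecay, heqv, hP.nontrivial⟩

/-! ## 5. Bookkeeping: the chain of implications the census quotes -/

/-- `S⁺_hyp → X → W0 → ¬NSR` and `X → ¬#3 → W_a`-type projections compose. [folklore] -/
theorem chain_summary :
    (HyperbolicPolyhedralProfileExists → QuantisedSymmetry.PolyhedralDssProfileExists) ∧
    (QuantisedSymmetry.PolyhedralDssProfileExists → DssFarFieldSlaving.BlowupTypeIDssProfile) ∧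
    (DssFarFieldSlaving.BlowupTypeIDssProfile → ¬ _root_.NavierStokesRegularity) ∧
    (QuantisedSymmetry.PolyhedralDssProfileExists → NotPolyhedralLiouville) ∧
    (QuantisedSymmetry.PolyhedralDssProfileExists → TypeIAncientProfileExists) :=
  ⟨crux_of_hyperbolic, crux_imp_W0, W0_decides, crux_imp_notPolyhedralLiouville,
    crux_imp_typeIAncientProfileExists⟩

end Summit.NavierStokesRegularity.NavierStokesRegularity.Cruxes.PolyhedralDssProfileExists.StrategistS21g10
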